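import Summits.Schanuel.Schanuel.Theorems.ZilberEacDensityRealSlopeLevel
import HarnessLib

/-!
# Line surfaces of REAL irrational slope: Zariski density of the exponential points

HONEST FRAMING.  This file (with its two lemma files `ZilberEacDensityRealSlopeLemmas`,
`ZilberEacDensityRealSlopeLevel`) proves modest rungs of the case ladder of ZILBER'S EXPONENTIAL-ALGEBRAIC
CLOSEDNESS conjecture (EAC) — instances of the Mantova–Masser "unprojected density" question for an
explicit family of algebraic SURFACES in `ℂ² × (ℂˣ)²`.  It is NOT Schanuel's conjecture, it does not
use Schanuel's conjecture, and EAC does not imply Schanuel's conjecture.  The general surface case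
`EC(3,2)` of EAC and the Mantova–Masser density question in general remain OPEN; nothing here bears
on them beyond the stated family.

## What is proved (new)

For the LINE SURFACES `S_{a,b,q} = {x₁ = a x₀ + b, y₀ = q(y₁)}` (`linePoly a b`, fibre polynomial
`q ∈ ℂ[y₁]`), whose exponential points are the solutions of the one-variable equation
`e^{z} = q(e^{a z + b})`:

* `unprojectedDense_lineSurface_real` — for `a ∈ ℝ \ ℚ`, every `b ∈ ℂ` and every `q ≠ 0`, the
  exponential points of `S_{a,b,q}` are Zariski dense: `I(S ∩ Γ_exp) = I(S)` (`UnprojectedDense`).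
* `unprojectedDense_lineSurface_of_forall_rat_ne` — hence for EVERY `a ∈ ℂ \ ℚ` (the non-real
  slopes were settled in `Literature.ModelTheory.Zilber.EACDensityLineTwist` by the escape regime).
* `unprojectedDense_lineSurface_of_mmCase` — consequently the typed Mantova–Masser density question
  (`MMCaseDimPiOneFree S → UnprojectedDense S`) HOLDS ON THE WHOLE LINE FAMILY `{S_{a,b,q}}`
  (`a, b ∈ ℂ`, `q ∈ ℂ[y₁]` arbitrary), with `mmCase_and_unprojectedDense_lineSurface_iff`
  recording that on this family "in the case" already forces density (both say `a ∉ ℚ`).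
* `unprojectedDense_alignedSurface_line_of_forall_rat_ne`,
  `unprojectedDensityQuestion_alignedSurface_line` — the aligned family
  `{x₁ = a x₀ + b, y₁ = q(y₀)}` (equation `e^{a z + b} = q(e^{z})`), by the index swap.

The real-slope case was the one left open by `EACDensityLineTwist` (its docstring, last section):
for real `a` and non-monomial `q` all exponential points have `Re z` confined to a vertical strip,
so no coordinate escapes and none of the decay / rotation criteria of the `EACDensity*` files can
apply.  Example decided here: `e^{z} = 1 + e^{√2 z}`.

## Method (classical; the assembly for the density question is new)

The argument is the Kronecker–Rouché method for zeros of exponential polynomials with real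
frequencies (C. J. Moreno, *The zeros of exponential polynomials (I)*, Compositio Math. 26 (1973);
C. E. Avellar – J. K. Hale, *On the zeros of exponential polynomials*, J. Math. Anal. Appl. 73
(1980), Theorem 3.1: the closure of the real parts of the zeros is the set where the "torus
equation" has a unimodular solution), re-proved here from Mathlib in the form needed and pushed one
step further to control the FIBRE coordinate `w = e^{a z + b}`:

* Part A (`…Lemmas`, elimination): if a polynomial `G(w, z)` vanishes at exponential points with `|z_k| → ∞`
  and `w_k → w₀` for INFINITELY many `w₀`, then `G = 0` (leading `z`-coefficient has infinitely
  many roots; builds on `tendsto_norm_leadingCoeff_eval` of `EACDensityOscillatory`).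
* Part B (`…Lemmas`, Kronecker): `{e^{2πi n a} : |n| ≥ N}` is dense in the unit circle for `a ∉ ℚ`
  (`dense_addSubgroupClosure_pair_iff`).
* Part C (`…Lemmas`, Rouché replaced by the minimum-modulus principle): a holomorphic `f` with `|f| ≥ m` on a
  circle and `|f(c)| < m` at the centre has a zero inside (maximum modulus for `1/f`).
* Part D (`…Level`): `Φ_u(ζ) = e^{ζ} - q(u e^{aζ+b})` is entire and `≢ 0` (`e^{2πi a}` is not a root of
  unity).
* Part E (`…Level`, the new input for the fibre): the level curve `|w| = e^{Re b}|q(w)|^{a}` off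
  `{0} ∪ q⁻¹(0)` is INFINITE — `ψ = log|w| - a log|q(w)| - Re b` tends to `-∞` at `0` and to `+∞`
  at `∞` or at a root of `q` (according to the sign of `1 - a·deg q`, non-zero as `a ∉ ℚ`), and the
  complement of a finite subset of `ℂ` is connected (intermediate value theorem).
* Part F (this file): every point `w₀` of the level curve is a limit of fibre coordinates of exponential points
  with `|z| → ∞` (Kronecker approximation of the unimodular `u₀ = w₀ e^{-(a x₀ + b)}` by
  `e^{2πi n a}`, `|n| → ∞`, and persistence of the zero `x₀` of `Φ_{u₀}` under the perturbation
  `u₀ ↦ e^{2πi n a}` by Part C).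
* Part G (this file): A + E + F, the fibre twist `unprojectedDense_lineSurface_pow_mul_iff` of
  `EACDensityLineTwist` to reduce to `q(0) ≠ 0`, and the case analysis `Im a = 0 / ≠ 0`.

No statement of Mantova–Masser or Zilber is used as a hypothesis; the only inputs are Mathlib and
the (proved) infrastructure of the `Literature.ModelTheory.Zilber.EACDensity*` files.
-/

noncomputable section

open Filter Topology Metric Set Complex Polynomial Bornology
open Literature.NumberTheory.Transcendental Literature.ModelTheory.Zilber
open Literature.ModelTheory.ExponentialFields

set_option linter.dupNamespace false

namespace Summit.Schanuel.Schanuel.Theorems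

/-! ## Part F. Zeros near a point of the level curve, and the sequences -/

section Construction

/-- `|e^{aζ+b}| ≤ e^{|a|(|x₀|+r)+|b|}` on `closedBall x₀ r`. -/
theorem norm_exp_line_le (a : ℝ) (b x₀ : ℂ) {r : ℝ} {ζ : ℂ} (hζ : ζ ∈ closedBall x₀ r) :
    ‖exp ((a : ℂ) * ζ + b)‖ ≤ Real.exp (|a| * (‖x₀‖ + r) + ‖b‖) := by
  refine (Complex.norm_exp_le_exp_norm _).trans (Real.exp_le_exp.2 ?_)
  have h1 : ‖ζ‖ ≤ ‖x₀‖ + r := by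
    have h := mem_closedBall.1 hζ
    rw [dist_eq_norm] at h
    calc ‖ζ‖ = ‖x₀ + (ζ - x₀)‖ := by rw [add_sub_cancel]
      _ ≤ ‖x₀‖ + ‖ζ - x₀‖ := norm_add_le _ _
      _ ≤ ‖x₀‖ + r := by linarith
  calc ‖(a : ℂ) * ζ + b‖ ≤ ‖(a : ℂ) * ζ‖ + ‖b‖ := norm_add_le _ _
    _ = |a| * ‖ζ‖ + ‖b‖ := by rw [norm_mul, Complex.norm_real, Real.norm_eq_abs]
    _ ≤ |a| * (‖x₀‖ + r) + ‖b‖ := by gcongr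

/-- **Zeros near a zero, with a large rotation** (Kronecker + minimum modulus): if `|u₀| = 1` and
`Φ_{u₀}(x₀) = 0`, then for every `ε > 0` and `N` there are `n ∈ ℤ`, `|n| ≥ N`, with
`|e^{2πi n a} - u₀| < ε`, and a zero `ζ` of `Φ_{e^{2πi n a}}` with `|ζ - x₀| < ε`.  (The zeros of
`Φ_{u₀}` are isolated, so `|Φ_{u₀}| ≥ m > 0` on a small circle about `x₀`; for `u` close to `u₀`,
`Φ_u` is within `m/2` of `Φ_{u₀}` on the closed disc, hence has a zero inside.) (new) -/
theorem exists_zero_lineFn_near {a : ℝ} (ha : Irrational a) (b : ℂ) (q : Polynomial ℂ)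
    {u₀ x₀ : ℂ} (hu₀ : ‖u₀‖ = 1) (hx₀ : lineFn a b q u₀ x₀ = 0) {ε : ℝ} (hε : 0 < ε) (N : ℕ) :
    ∃ n : ℤ, ∃ ζ : ℂ, (N : ℝ) ≤ |(n : ℝ)| ∧ ‖urot (n * a) - u₀‖ < ε ∧ ‖ζ - x₀‖ < ε ∧
      lineFn a b q (urot (n * a)) ζ = 0 := by
  have hu₀0 : u₀ ≠ 0 := by rw [← norm_pos_iff, hu₀]; exact one_pos
  obtain ⟨r, hr0, hrε, m, hm0, hm⟩ := exists_sphere_norm_le (differentiable_lineFn a b q u₀)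
    (exists_lineFn_ne_zero ha b q hu₀0) x₀ hε
  set V : ℝ := Real.exp (|a| * (‖x₀‖ + r) + ‖b‖) with hV
  have hV0 : 0 < V := Real.exp_pos _
  obtain ⟨δ, hδ0, hδ⟩ := Metric.uniformContinuousOn_iff.1
    ((isCompact_closedBall (0 : ℂ) V).uniformContinuousOn_of_continuous
      q.continuous.continuousOn) (m / 2) (half_pos hm0)
  obtain ⟨n, hn, hnu⟩ := exists_urot_near ha hu₀ (lt_min hε (div_pos hδ0 hV0)) N
  have hnuε : ‖urot (n * a) - u₀‖ < ε := hnu.trans_le (min_le_left _ _)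
  have hnuδ : ‖urot (n * a) - u₀‖ < δ / V := hnu.trans_le (min_le_right _ _)
  set u := urot (n * a) with hu
  have hu1 : ‖u‖ = 1 := norm_urot _
  have hcmp : ∀ ζ ∈ closedBall x₀ r, ‖lineFn a b q u ζ - lineFn a b q u₀ ζ‖ < m / 2 := by
    intro ζ hζ
    set v := exp ((a : ℂ) * ζ + b) with hv
    have hvV : ‖v‖ ≤ V := norm_exp_line_le a b x₀ hζ
    have e : lineFn a b q u ζ - lineFn a b q u₀ ζ = q.eval (u₀ * v) - q.eval (u * v) := by
      simp only [lineFn]; ring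
    rw [e, ← dist_eq_norm]
    refine hδ (u₀ * v) ?_ (u * v) ?_ ?_
    · rw [mem_closedBall, dist_zero_right, norm_mul, hu₀, one_mul]; exact hvV
    · rw [mem_closedBall, dist_zero_right, norm_mul, hu1, one_mul]; exact hvV
    · rw [dist_eq_norm, ← sub_mul, norm_mul]
      calc ‖u₀ - u‖ * ‖v‖ ≤ ‖u₀ - u‖ * V := mul_le_mul_of_nonneg_left hvV (norm_nonneg _)
        _ < δ / V * V := by
          refine mul_lt_mul_of_pos_right ?_ hV0
          rwa [norm_sub_rev]
        _ = δ := div_mul_cancel₀ δ hV0.ne'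
  have hsph : ∀ ζ ∈ sphere x₀ r, m / 2 ≤ ‖lineFn a b q u ζ‖ := by
    intro ζ hζ
    have h1 := hm ζ hζ
    have h2 := hcmp ζ (sphere_subset_closedBall hζ)
    have h3 : ‖lineFn a b q u₀ ζ‖ ≤ ‖lineFn a b q u ζ‖ + ‖lineFn a b q u ζ - lineFn a b q u₀ ζ‖ := by
      have := norm_sub_le (lineFn a b q u ζ) (lineFn a b q u ζ - lineFn a b q u₀ ζ)
      rwa [sub_sub_cancel] at this
    linarith
  have hctr : ‖lineFn a b q u x₀‖ < m / 2 := by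
    have := hcmp x₀ (mem_closedBall_self hr0.le)
    rwa [hx₀, sub_zero] at this
  obtain ⟨ζ, hζ, hzero⟩ := exists_zero_of_norm_lt_of_sphere hr0 (lt_add_one r)
    (differentiable_lineFn a b q u).differentiableOn hsph hctr
  refine ⟨n, ζ, hn, hnuε, ?_, hzero⟩
  have h := mem_ball.1 hζ
  rw [dist_eq_norm] at h
  exact h.trans_le hrε

/-- `|n · 2πi| = 2π |n|`. -/
theorem norm_intCast_mul_two_pi_I (n : ℤ) : ‖(n : ℂ) * (2 * Real.pi * I)‖ = 2 * Real.pi * |(n : ℝ)| := by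
  rw [norm_mul, Complex.norm_intCast]
  have : ‖(2 * Real.pi * I : ℂ)‖ = 2 * Real.pi := by
    simp [Complex.norm_real, Real.norm_eq_abs, abs_of_pos Real.pi_pos]
  rw [this]; ring

/-- **The sequences.** From a point `w₀` of the level curve (`w₀ ≠ 0`, `q(w₀) ≠ 0`,
`log|w₀| = a log|q(w₀)| + Re b`) we get exponential points `z_k` of the line surface —
`e^{z_k} = q(w_k)`, `e^{a z_k + b} = w_k` — with `|z_k| → ∞` and `w_k → w₀`: put
`x₀ = log q(w₀)`, `u₀ = w₀ e^{-(a x₀ + b)}` (unimodular by the level equation), so that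
`Φ_{u₀}(x₀) = 0`; Part F gives zeros `ζ_k → x₀` of `Φ_{e^{2πi n_k a}}` with `|n_k| → ∞` and
`e^{2πi n_k a} → u₀`, and `z_k = ζ_k + 2πi n_k`, `w_k = e^{2πi n_k a} e^{a ζ_k + b}`. (new) -/
theorem exists_seqs_of_mem_levelSet {a : ℝ} (ha : Irrational a) (b : ℂ) (q : Polynomial ℂ)
    {w₀ : ℂ} (hw₀ : w₀ ≠ 0) (hq₀ : q.eval w₀ ≠ 0)
    (hlev : Real.log ‖w₀‖ = a * Real.log ‖q.eval w₀‖ + b.re) :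
    ∃ z w : ℕ → ℂ, Tendsto (fun k => ‖z k‖) atTop atTop ∧ Tendsto w atTop (𝓝 w₀) ∧
      (∀ k, exp (z k) = q.eval (w k)) ∧ ∀ k, exp ((a : ℂ) * z k + b) = w k := by
  set x₀ := Complex.log (q.eval w₀) with hx₀
  set s := (a : ℂ) * x₀ + b with hs
  set u₀ := w₀ * exp (-s) with hu₀
  have hux : u₀ * exp ((a : ℂ) * x₀ + b) = w₀ := by
    rw [hu₀, mul_assoc, ← Complex.exp_add, ← hs, neg_add_cancel, Complex.exp_zero, mul_one]
  have hsre : s.re = Real.log ‖w₀‖ := by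
    rw [hs, Complex.add_re, Complex.re_ofReal_mul, hx₀, Complex.log_re, hlev]
  have hu₀1 : ‖u₀‖ = 1 := by
    rw [hu₀, norm_mul, Complex.norm_exp, Complex.neg_re, hsre, Real.exp_neg,
      Real.exp_log (norm_pos_iff.2 hw₀), mul_inv_cancel₀ (norm_ne_zero_iff.2 hw₀)]
  have hx : lineFn a b q u₀ x₀ = 0 := by
    rw [lineFn, hux, hx₀, Complex.exp_log hq₀, sub_self]
  choose n ζ hN hrot hζ hzero using fun j : ℕ =>
    exists_zero_lineFn_near ha b q hu₀1 hx (ε := 1 / ((j : ℝ) + 1)) (by positivity) j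
  refine ⟨fun j => ζ j + (n j : ℂ) * (2 * Real.pi * I),
    fun j => urot (n j * a) * exp ((a : ℂ) * ζ j + b), ?_, ?_, ?_, ?_⟩
  · have hlow : ∀ j : ℕ, 2 * Real.pi * j + (-(‖x₀‖ + 1)) ≤ ‖ζ j + (n j : ℂ) * (2 * Real.pi * I)‖ := by
      intro j
      have h1 := norm_intCast_mul_two_pi_I (n j)
      have h2 : ‖ζ j‖ < ‖x₀‖ + 1 := by
        have h := hζ j
        have h1' : (1 : ℝ) / ((j : ℝ) + 1) ≤ 1 := by
          rw [div_le_one (by positivity)]; linarith [(Nat.cast_nonneg j : (0 : ℝ) ≤ j)]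
        calc ‖ζ j‖ = ‖x₀ + (ζ j - x₀)‖ := by rw [add_sub_cancel]
          _ ≤ ‖x₀‖ + ‖ζ j - x₀‖ := norm_add_le _ _
          _ < ‖x₀‖ + 1 := by linarith
      have h3 : ‖(n j : ℂ) * (2 * Real.pi * I)‖ - ‖ζ j‖ ≤ ‖ζ j + (n j : ℂ) * (2 * Real.pi * I)‖ := by
        have := norm_sub_le (ζ j + (n j : ℂ) * (2 * Real.pi * I)) (ζ j)
        rw [add_sub_cancel_left] at this
        linarith
      have h4 : 2 * Real.pi * (j : ℝ) ≤ 2 * Real.pi * |(n j : ℝ)| :=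
        mul_le_mul_of_nonneg_left (hN j) (by positivity)
      linarith
    refine tendsto_atTop_mono hlow ?_
    have h2pi : Tendsto (fun j : ℕ => 2 * Real.pi * (j : ℝ)) atTop atTop :=
      tendsto_natCast_atTop_atTop.const_mul_atTop (by positivity)
    exact tendsto_atTop_add_const_right atTop (-(‖x₀‖ + 1)) h2pi
  · have hrot' : Tendsto (fun j => urot (n j * a)) atTop (𝓝 u₀) := by
      rw [tendsto_iff_norm_sub_tendsto_zero]
      exact squeeze_zero (fun j => norm_nonneg _) (fun j => (hrot j).le)
        tendsto_one_div_add_atTop_nhds_zero_nat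
    have hζ' : Tendsto ζ atTop (𝓝 x₀) := by
      rw [tendsto_iff_norm_sub_tendsto_zero]
      exact squeeze_zero (fun j => norm_nonneg _) (fun j => (hζ j).le)
        tendsto_one_div_add_atTop_nhds_zero_nat
    have hexp : Tendsto (fun j => exp ((a : ℂ) * ζ j + b)) atTop (𝓝 (exp ((a : ℂ) * x₀ + b))) := by
      have hc : Continuous fun ζ : ℂ => exp ((a : ℂ) * ζ + b) :=
        Complex.continuous_exp.comp ((continuous_const.mul continuous_id).add continuous_const)
      exact (hc.tendsto x₀).comp hζ'
    rw [← hux]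
    exact hrot'.mul hexp
  · intro j
    have h0 := hzero j
    rw [lineFn, sub_eq_zero] at h0
    rw [Complex.exp_add, Complex.exp_int_mul_two_pi_mul_I, mul_one, h0]
  · intro j
    dsimp only
    have e : (a : ℂ) * (ζ j + (n j : ℂ) * (2 * Real.pi * I)) + b =
        ((a : ℂ) * ζ j + b) + (((n j : ℝ) * a : ℝ) : ℂ) * (2 * Real.pi * I) := by
      push_cast; ring
    rw [e, Complex.exp_add ((a : ℂ) * ζ j + b)]
    simp only [urot]
    ring

end Construction

/-! ## Part G. The theorems -/

section Main

/-- `a ∉ ℚ` for the complexified real `a` iff `a` is irrational. -/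
theorem forall_rat_ne_coe_iff {x : ℝ} : (∀ r : ℚ, (x : ℂ) ≠ (r : ℂ)) ↔ Irrational x := by
  constructor
  · rintro h ⟨r, rfl⟩
    exact h r (by push_cast; rfl)
  · rintro h r e
    exact h ⟨r, by exact_mod_cast e.symm⟩

/-- **Core theorem** (`a ∈ ℝ \ ℚ`, `q(0) ≠ 0`): the exponential points of the line surface
`{x₁ = a x₀ + b, y₀ = q(y₁)}` — the solutions of `e^{z} = q(e^{a z + b})` — are Zariski dense,
`I(S ∩ Γ_exp) = I(S)`: by Part E the level curve is infinite, by Part F each of its points is a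
limit of fibre coordinates of exponential points escaping vertically, and by Part A a polynomial
vanishing on all of them pulls back to `0 ∈ ℂ[w][z]`. (new) -/
theorem unprojectedDense_lineSurface_real_of_eval_ne_zero {a : ℝ} (ha : Irrational a) (b : ℂ)
    {q : Polynomial ℂ} (hq0 : q.eval 0 ≠ 0) :
    UnprojectedDense (graphPolySurface (linePoly a b) q) := by
  refine unprojectedDense_graphPolySurface_of_limits (linePoly a b) q (levelSet_infinite ha b hq0)
    fun w₀ hw₀ => ?_
  obtain ⟨hw0, hqw, hpsi⟩ := hw₀
  have hlev : Real.log ‖w₀‖ = a * Real.log ‖q.eval w₀‖ + b.re := by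
    simp only [psi] at hpsi; linarith
  obtain ⟨z, w, hz, hw, he1, he2⟩ := exists_seqs_of_mem_levelSet ha b q hw0 hqw hlev
  exact ⟨z, w, hz, hw, he1, fun k => by rw [eval_linePoly]; exact he2 k⟩

/-- **Line surfaces of real irrational slope, every fibre** (`a ∈ ℝ \ ℚ`, `q ≠ 0`): Zariski dense
exponential points — the fibre twist of `EACDensityLineTwist` reduces to `q(0) ≠ 0` over the slope
`a/(1 - m a)`, again real irrational. (new) -/
theorem unprojectedDense_lineSurface_real {a : ℝ} (ha : Irrational a) (b : ℂ) {q : Polynomial ℂ}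
    (hq : q ≠ 0) : UnprojectedDense (graphPolySurface (linePoly a b) q) := by
  classical
  obtain ⟨q₁, hfac, hndvd⟩ := Polynomial.exists_eq_pow_rootMultiplicity_mul_and_not_dvd q hq 0
  rw [map_zero, sub_zero] at hfac hndvd
  set m := Polynomial.rootMultiplicity 0 q
  have hq₁0 : q₁.eval 0 ≠ 0 := by
    rwa [← Polynomial.coeff_zero_eq_eval_zero, ne_eq, ← Polynomial.X_dvd_iff]
  have hq₁ : q₁ ≠ 0 := by
    rintro rfl
    exact hq₁0 (Polynomial.eval_zero)
  have ha' : ∀ r : ℚ, (a : ℂ) ≠ (r : ℂ) := forall_rat_ne_coe_iff.2 ha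
  have hl : (1 : ℂ) - m * (a : ℂ) ≠ 0 := one_sub_natCast_mul_ne_zero_of_forall_rat_ne ha' m
  rw [hfac, unprojectedDense_lineSurface_pow_mul_iff (a : ℂ) b m hq₁ hl]
  have hcast : (a : ℂ) / (1 - m * (a : ℂ)) = ((a / (1 - m * a) : ℝ) : ℂ) := by push_cast; rfl
  have ha'' : Irrational (a / (1 - m * a)) := by
    refine forall_rat_ne_coe_iff.1 ?_
    rw [← hcast]
    exact (forall_rat_ne_div_one_sub_iff m hl).2 ha'
  rw [hcast]
  exact unprojectedDense_lineSurface_real_of_eval_ne_zero ha'' _ hq₁0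

/-- **Every line surface of irrational slope has Zariski dense exponential points** (`a ∈ ℂ \ ℚ`,
`q ≠ 0`): non-real slopes by `EACDensityLineTwist.unprojectedDense_lineSurface_of_ne_zero`
(escape regime), real irrational slopes by `unprojectedDense_lineSurface_real` (this file: Kronecker
+ minimum modulus, no escape regime). (new) -/
theorem unprojectedDense_lineSurface_of_forall_rat_ne {a : ℂ} (ha : ∀ r : ℚ, a ≠ (r : ℂ)) (b : ℂ)
    {q : Polynomial ℂ} (hq : q ≠ 0) : UnprojectedDense (graphPolySurface (linePoly a b) q) := by
  by_cases him : a.im = 0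
  · have hre : ((a.re : ℝ) : ℂ) = a := Complex.ext (by simp) (by simp [him])
    have hirr : Irrational a.re := forall_rat_ne_coe_iff.1 (by rw [hre]; exact ha)
    rw [← hre]
    exact unprojectedDense_lineSurface_real hirr b hq
  · exact unprojectedDense_lineSurface_of_ne_zero b him hq

/-- **Mantova–Masser's density question holds on the whole family of line surfaces**
`S = {x₁ = a x₀ + b, y₀ = q(y₁)}` (`a, b ∈ ℂ`, `q ∈ ℂ[y₁]` arbitrary): if `S` is in the case
(dim-π-S-1-free) then its exponential points are Zariski dense.  (In the case forces `q ≠ 0` and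
`a ∉ ℚ`, `mmCase_graphPolySurface_line_iff`.) (new) -/
theorem unprojectedDense_lineSurface_of_mmCase (a b : ℂ) (q : Polynomial ℂ)
    (h : MMCaseDimPiOneFree (graphPolySurface (linePoly a b) q)) :
    UnprojectedDense (graphPolySurface (linePoly a b) q) := by
  have hq : q ≠ 0 := ne_zero_of_graphPolySurface_inter_torusLocus_nonempty h.2.1
  exact unprojectedDense_lineSurface_of_forall_rat_ne ((mmCase_graphPolySurface_line_iff a b hq).1 h)
    b hq

/-- On the line family "in the case" and "in the case with dense exponential points" coincide and
both mean `a ∉ ℚ` (`q ≠ 0`). (new) -/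
theorem mmCase_and_unprojectedDense_lineSurface_iff (a b : ℂ) {q : Polynomial ℂ} (hq : q ≠ 0) :
    (MMCaseDimPiOneFree (graphPolySurface (linePoly a b) q) ∧
      UnprojectedDense (graphPolySurface (linePoly a b) q)) ↔ ∀ r : ℚ, a ≠ (r : ℂ) :=
  ⟨fun h => (mmCase_graphPolySurface_line_iff a b hq).1 h.1, fun ha =>
    ⟨mmCase_graphPolySurface_line ha hq, unprojectedDense_lineSurface_of_forall_rat_ne ha b hq⟩⟩

/-- **Aligned line surfaces** `{x₁ = a x₀ + b, y₁ = q(y₀)}` (the equation `e^{a z + b} = q(e^z)`),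
`a ∉ ℚ`, `q ≠ 0`: Zariski dense exponential points, by the index swap onto the line surface of
slope `a⁻¹`. (new) -/
theorem unprojectedDense_alignedSurface_line_of_forall_rat_ne {a : ℂ} (ha : ∀ r : ℚ, a ≠ (r : ℂ))
    (b : ℂ) {q : Polynomial ℂ} (hq : q ≠ 0) : UnprojectedDense (alignedSurface (linePoly a b) q) := by
  have ha0 : a ≠ 0 := fun h => ha 0 (by rw [h, Rat.cast_zero])
  rw [alignedSurface_line_eq_indexSwapped ha0, unprojectedDense_indexSwapped_iff]
  exact unprojectedDense_lineSurface_of_forall_rat_ne ((forall_rat_ne_inv_iff a).2 ha) _ hq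

/-- The question on the aligned line family: in the case AND dense, for every `a ∉ ℚ`, `q ≠ 0`.
(new) -/
theorem unprojectedDensityQuestion_alignedSurface_line {a : ℂ} (ha : ∀ r : ℚ, a ≠ (r : ℂ))
    (b : ℂ) {q : Polynomial ℂ} (hq : q ≠ 0) :
    MMCaseDimPiOneFree (alignedSurface (linePoly a b) q) ∧
      UnprojectedDense (alignedSurface (linePoly a b) q) :=
  ⟨mmCase_alignedSurface_line b ha hq, unprojectedDense_alignedSurface_line_of_forall_rat_ne ha b hq⟩

/-- Example (the case left OPEN by `EACDensityLineTwist`): `e^{z} = 1 + e^{√2 z}` — the exponential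
points of `{x₁ = √2 x₀, y₀ = 1 + y₁}` (real irrational slope, non-monomial fibre: all zeros in a
vertical strip, no escape regime, multiplicatively free fibre) are Zariski dense. -/
example : UnprojectedDense (graphPolySurface (linePoly (Real.sqrt 2 : ℂ) 0) (1 + Polynomial.X)) :=
  unprojectedDense_lineSurface_real irrational_sqrt_two 0 (by
    intro h
    have := congrArg (Polynomial.eval (0 : ℂ)) h
    norm_num at this)

end Main

end Summit.Schanuel.Schanuel.Theorems
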